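/-
Copyright (c) 2026. All rights reserved.
Released under Apache 2.0 license as described in the file LICENSE.
Authors: abc-iut cell, Cor. 3.12 sub-crew seat abc-iut-c312-3 (gen 9).
-/
import Literature.IUT.LogVolume.UnitLogInnerRadiusTieRoots
import HarnessLib

/-!
# The inner radius at a TIE index `e = A·(p−1)` (`p` odd, `p ∤ A`), III: `ζ_p ∈ K` ⇒ `r_in = A + 1`

Proof-only sequel (theorems, no definitions, no named fact) of `UnitLogInnerRadiusTie(Roots).lean`.
Setting: `K` a proper ultrametric normed `ℚ_p`-algebra field, `p` ODD, `e = absRamificationIdx p K = A·(p−1)`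
with `p ∤ A`, `ϖ` a norm uniformizer, `c = ϖ^e/p`, `Λ = log_p(𝒪_K^×)`.

* §6 `exists_exponent_norm_logSeries_off_level`: a principal unit `y ≠ 1` of level `s ≠ A` has
  `‖L(y)‖ = ‖ϖ‖^β` with `β ≤ A − 2` or `β ≥ A + 1` (strict level envelopes) — so a principal unit whose
  logarithm has norm EXACTLY `‖ϖ‖^A` has level `A` (`norm_one_sub_eq_of_norm_logSeries_eq`).
* §7 **`ζ_p ∈ K` ⇒ `{‖z‖ ≤ ‖ϖ‖^A} ⊄ Λ`** (`not_closedBall_level_subset_logUnits_of_pow_prime_eq_one`): the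
  unit zero `(ζ − 1)/ϖ^A` of the residue polynomial `ā ↦ ā + c̄·ā^p` (part II) makes this ADDITIVE map of
  the finite residue field non-injective, hence NOT onto: pick a residue class `b̄` off its image (`b` a
  unit); were `ϖ^A·b = log_p u`, then for a prime-to-`p` power `y = u^m` one has `L(y) = ϖ^A·(m b)` of norm
  `‖ϖ‖^A`, so `y` has level `A` (§6), `y = 1 + ϖ^A a`, and the level-`A` congruence gives
  `a + c·a^p ≡ m·b`; with `m·m' ≡ 1 (mod p)` and `𝔽_p`-linearity, `a' = m'·a` has `a' + c·a'^p ≡ b` —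
  contradiction.  Hence **`r_in = A + 1` EXACTLY when `ζ_p ∈ K`** (`innerRadius_tie_of_pow_prime_eq_one`:
  `closedBall 0 ‖ϖ‖^{A+1} ⊆ Λ ∧ ¬ closedBall 0 ‖ϖ‖^A ⊆ Λ`), completing, with parts I–II and
  `UnitLogValuationSpectrum`, the closed form of the inner radius at EVERY index `e` with `p ∤ e`, `p` odd:
  `r_in = ⌊e/(p−1)⌋ + 1` if `(p−1) ∤ e`; `= e/(p−1) + [ζ_p ∈ K]` if `(p−1) ∣ e`.
* §8 the INNER-RADIUS BINDERS (`hc0`/`hc`/`hmax`) of abc-iut-c312-5's `smul_normalizedPacket_subset_logPacket_iff`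
  DISCHARGED at tie places: `innerRadius_tie_hyps_of_forall_pow_prime_eq_one` (`c = ϖ^A`),
  `innerRadius_tie_hyps_of_pow_prime_eq_one` (`c = ϖ^{A+1}`, `exists_norm_eq_not_mem_logUnits_of_pow_prime_eq_one`).

References: [cite: NeukirchANT1999, Ch. II Prop. (5.5)–(5.7)] [cite: Washington1997, Lemma 1.4, §5.1].
Classical; `logUnits` is the cell's typing of [IUTchIV] Prop. 1.2's `log_p(R^×)` ([claim: Mochizuki2012,
status: disputed] for that locution only).  Consumer (record only): D-0079 R-W lane U column «rho_in».
Nothing here is disputed mathematics; no IUT statement is asserted; nothing bears on [IUTchIII] Cor. 3.12.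
-/

noncomputable section

open Metric Set
open scoped NormedField

namespace Literature.IUT.LogVolume

namespace LogEnvelope

open RamificationCriterion BoundaryRamification Literature.NumberTheory.GaloisRepresentations.Ultrametric
  IsLocalRing

section Field

variable (p : ℕ) [hp : Fact p.Prime]
variable {K : Type*} [NontriviallyNormedField K] [instK : NormedAlgebra ℚ_[p] K] [IsUltrametricDist K]
  [ProperSpace K]
variable {ϖ : Kˣ} (hϖ : IsUniformizer ϖ) {A : ℕ} (hA : absRamificationIdx p K = A * (p - 1))
include hϖ hA

/-! ### §6. Principal units off the critical level -/

/-- **Off the critical level the logarithm avoids the exponents `A − 1` and `A`**: a principal unit `y ≠ 1`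
of level `s ≠ A` (`‖1 − y‖ = ‖ϖ‖^s`) has `‖L(y)‖ = ‖ϖ‖^β` with `β ≤ A − 2` (if `s < A`: `β ≤ s·p − e < s`) or
`β ≥ A + 1` (if `s > A`: `β = s`), `p ∤ A`. [cite: NeukirchANT1999, Ch. II (5.5)] -/
theorem exists_exponent_norm_logSeries_off_level (hpA : ¬ p ∣ A) {y : K} {s : ℤ} (hs1 : 1 ≤ s)
    (hs : ‖1 - y‖ = ‖(ϖ : K)‖ ^ s) (hsA : s ≠ A) :
    ∃ β : ℤ, ‖logSeries y‖ = ‖(ϖ : K)‖ ^ β ∧ (β ≤ (A : ℤ) - 2 ∨ (A : ℤ) + 1 ≤ β) := by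
  have hP : (2 : ℤ) ≤ (p : ℤ) := by exact_mod_cast hp.out.two_le
  have hp1 : 1 ≤ p := hp.out.one_le
  obtain ⟨a₀, hlo, hhi⟩ := exists_turning_level (p := p) hs1 (absRamificationIdx p K)
  have hhi' := lt_of_le_of_ne_level p hA hpA hs1 hsA hhi
  refine ⟨s * (p : ℤ) ^ a₀ - (absRamificationIdx p K : ℤ) * (a₀ : ℤ),
    norm_logSeries_eq_zpow_level p hϖ hs1 hlo hhi' hs, ?_⟩
  set e : ℕ := absRamificationIdx p K with he_def
  have heA : (e : ℤ) = (A : ℤ) * ((p : ℤ) - 1) := by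
    rw [hA]; push_cast [Nat.cast_sub hp1]; ring
  rcases lt_or_gt_of_ne hsA with hlt | hgt
  · left
    have hsl : s * ((p : ℤ) - 1) < e := by
      rw [heA]; exact mul_lt_mul_of_pos_right hlt (by linarith)
    have ha₀ : a₀ ≠ 0 := by
      rintro rfl
      rw [pow_zero, mul_one] at hhi'
      exact absurd hhi' (not_lt.mpr hsl.le)
    have hmin := exponent_min (a₀ := a₀) hs1 hP hlo hhi'.le 1
    rw [pow_one, Nat.cast_one, mul_one] at hmin
    nlinarith
  · right
    have ha₀ : a₀ = 0 := by
      by_contra h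
      have h0 := hlo 0 (Nat.pos_of_ne_zero h)
      rw [pow_zero, mul_one] at h0
      have : (A : ℤ) * ((p : ℤ) - 1) < s * ((p : ℤ) - 1) := mul_lt_mul_of_pos_right hgt (by linarith)
      linarith
    subst ha₀
    rw [pow_zero, mul_one, Nat.cast_zero, mul_zero, sub_zero]
    omega

/-- **A principal unit whose logarithm has norm exactly `‖ϖ‖^A` has level `A`** (`p ∤ A`).
[cite: NeukirchANT1999, Ch. II (5.5)] -/
theorem norm_one_sub_eq_of_norm_logSeries_eq (hpA : ¬ p ∣ A) {y : K} (hyP : IsPrincipal y)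
    (hL : ‖logSeries y‖ = ‖(ϖ : K)‖ ^ A) : ‖1 - y‖ = ‖(ϖ : K)‖ ^ A := by
  have hρ0 : 0 < ‖(ϖ : K)‖ := norm_units_pos ϖ
  have hy1 : y ≠ 1 := by
    rintro rfl
    rw [logSeries_one, norm_zero] at hL
    exact (ne_of_gt (pow_pos hρ0 _)) hL.symm
  have hx : (1 : K) - y ≠ 0 := sub_ne_zero.mpr (Ne.symm hy1)
  obtain ⟨s, hs⟩ := hϖ.2 (Units.mk0 (1 - y) hx)
  rw [Units.val_mk0] at hs
  have hs1 : 1 ≤ s := by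
    have h1 : ‖(ϖ : K)‖ ^ s < 1 := hs ▸ hyP
    have := (zpow_lt_one_iff_right_of_lt_one₀ hρ0 hϖ.1).mp h1
    omega
  by_cases hsA : s = A
  · rw [hs, hsA, zpow_natCast]
  · exfalso
    obtain ⟨β, hβ, hcase⟩ := exists_exponent_norm_logSeries_off_level p hϖ hA hpA hs1 hs hsA
    rw [hβ, ← zpow_natCast] at hL
    have := zpow_right_injective₀ hρ0 hϖ.1.ne hL
    omega

/-! ### §7. `ζ_p ∈ K`: the critical level is NOT full, `r_in = A + 1` -/

/-- **`ζ_p ∈ K` ⇒ `{‖z‖ ≤ ‖ϖ‖^A} ⊄ log_p(𝒪_K^×)`** (`p` odd, `e = A(p−1)`, `p ∤ A`): the additive residue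
polynomial `ā ↦ ā + c̄·ā^p` has the non-zero zero `(ζ − 1)/ϖ^A`, so it is not onto the finite residue field;
a unit `b` whose class is missed gives `ϖ^A·b ∉ log_p(𝒪_K^×)` (were it `log_p u`, a prime-to-`p` power
`y = u^m` would have `L(y) = ϖ^A·m·b`, level `A`, and the level-`A` congruence together with
`𝔽_p`-linearity would put `b̄` in the image). [cite: Washington1997, §5.1] [cite: NeukirchANT1999, Ch. II Prop. (5.7)] -/
theorem not_closedBall_level_subset_logUnits_of_pow_prime_eq_one (hp2 : p ≠ 2) (hpA : ¬ p ∣ A) {ζ : K}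
    (hζ : ζ ^ p = 1) (hζ1 : ζ ≠ 1) : ¬ closedBall (0 : K) (‖(ϖ : K)‖ ^ A) ⊆ logUnits K := by
  intro hsub
  have hρ0 : 0 < ‖(ϖ : K)‖ := norm_units_pos ϖ
  have hϖA0 : (ϖ : K) ^ A ≠ 0 := pow_ne_zero _ ϖ.ne_zero
  have hpn : ‖(p : K)‖ < 1 := norm_prime_lt_one p K
  -- natural numbers have norm `≤ 1` (the tree's `LinGroupK.norm_natCast_le_one'`, restated inline)
  have hnat : ∀ n : ℕ, ‖(n : K)‖ ≤ 1 := fun n => by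
    rw [norm_natCast_eq_padicNorm p K n]
    exact_mod_cast Padic.norm_int_le_one (n : ℤ)
  have hc1 := norm_coeff_level_eq_one p hϖ
  let C : Valued.integer K := ⟨(ϖ : K) ^ absRamificationIdx p K / (p : K), Valued.integer.mem_iff.mpr hc1.le⟩
  haveI := charP_residueField p K
  haveI : Finite (ResidueField (Valued.integer K)) := finite_residueField
  -- the residue polynomial is not injective, hence not surjective
  obtain ⟨a₁, ha₁, -, hΛ₁⟩ := exists_unit_zero_of_pow_prime_eq_one p hϖ hA hp2 hpA hζ hζ1
  obtain ⟨x₁, hx₁, hx₁0⟩ := exists_ne_zero_addPoly_eq_zero_of_norm p C ha₁ hΛ₁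
  let φ : ResidueField (Valued.integer K) → ResidueField (Valued.integer K) :=
    fun x => x + residue (Valued.integer K) C * x ^ p
  have hnotinj : ¬ Function.Injective φ := by
    intro hinj
    have h0 : φ 0 = 0 := by simp [φ, hp.out.ne_zero]
    exact hx₁ (hinj (hx₁0.trans h0.symm))
  have hnotsurj : ¬ Function.Surjective φ := fun h => hnotinj (Finite.injective_iff_surjective.mpr h)
  obtain ⟨yb, hyb⟩ : ∃ yb, ∀ x, φ x ≠ yb := by
    by_contra h
    push Not at h
    exact hnotsurj fun yb => by obtain ⟨x, hx⟩ := h yb; exact ⟨x, hx⟩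
  obtain ⟨B, hB⟩ := residue_surjective yb
  -- `b := B` is a unit and `a + c·a^p ≢ b (mod 𝔪)` for every `a ∈ 𝒪`
  have hmiss : ∀ a : K, ‖a‖ ≤ 1 → ¬ ‖a + (C : K) * a ^ p - (B : K)‖ < 1 := by
    intro a ha hlt
    let A' : Valued.integer K := ⟨a, Valued.integer.mem_iff.mpr ha⟩
    have h1 : residue (Valued.integer K) (A' + C * A' ^ p - B) = 0 := by
      rw [residue_eq_zero_iff_norm_lt_one, coe_add_mul_pow_sub]; exact hlt
    rw [map_sub, residue_add_mul_pow, sub_eq_zero, hB] at h1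
    exact hyb _ h1
  have hb1 : ‖(B : K)‖ = 1 := by
    refine le_antisymm (Valued.integer.norm_le_one B) (not_lt.mp fun hlt => ?_)
    refine hmiss 0 (by simp) ?_
    rw [zero_pow hp.out.ne_zero, mul_zero, zero_add, zero_sub, norm_neg]
    exact hlt
  -- suppose `ϖ^A·b ∈ log_p(𝒪^×)`
  have hz : (ϖ : K) ^ A * (B : K) ∈ closedBall (0 : K) (‖(ϖ : K)‖ ^ A) := by
    rw [mem_closedBall, dist_zero_right, norm_mul, norm_pow, hb1, mul_one]
  obtain ⟨u, hu1, hu⟩ := hsub hz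
  obtain ⟨m, hm0, hmp, hmP⟩ := exists_pow_isPrincipal_not_dvd (p := p) hu1
  have hmK : ‖(m : K)‖ = 1 := norm_natCast_eq_one_of_not_dvd p hmp
  have hm0K : (m : K) ≠ 0 := norm_ne_zero_iff.mp (by rw [hmK]; exact one_ne_zero)
  have hLy : logSeries (u ^ m) = (ϖ : K) ^ A * ((m : K) * (B : K)) := by
    have h := unitLog_eq_inv_mul_logSeries p hm0 hmP
    rw [hu] at h
    have := congrArg (fun z => (m : K) * z) h
    simp only [← mul_assoc, mul_inv_cancel₀ hm0K, one_mul] at this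
    rw [← this]; ring
  -- `y = u^m` has `‖L(y)‖ = ‖ϖ‖^A`, hence level `A`: `y = 1 + ϖ^A a`
  have hLn : ‖logSeries (u ^ m)‖ = ‖(ϖ : K)‖ ^ A := by
    rw [hLy, norm_mul, norm_pow, norm_mul, hmK, hb1, mul_one, mul_one]
  have hlev := norm_one_sub_eq_of_norm_logSeries_eq p hϖ hA hpA hmP hLn
  set a : K := (u ^ m - 1) / (ϖ : K) ^ A with hadef
  have ha : ‖a‖ ≤ 1 := by
    rw [hadef, norm_div, ← norm_neg, neg_sub, hlev, norm_pow, div_self (pow_ne_zero _ hρ0.ne')]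
  have hya : u ^ m = 1 + (ϖ : K) ^ A * a := by rw [hadef, mul_div_cancel₀ _ hϖA0]; ring
  -- the congruence: `a + c·a^p ≡ m·b (mod 𝔪)`
  have hcong := norm_logSeries_sub_le_level p hϖ hA hp2 ha
  rw [← hya, hLy, ← mul_sub, norm_mul, norm_pow, pow_succ] at hcong
  have hab : ‖(m : K) * (B : K) - (a + (C : K) * a ^ p)‖ < 1 :=
    (le_of_mul_le_mul_left hcong (pow_pos hρ0 _)).trans_lt hϖ.1
  -- invert `m` modulo `p`
  have hcop : Nat.Coprime m p := Nat.coprime_comm.mp ((Nat.Prime.coprime_iff_not_dvd hp.out).mpr hmp)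
  obtain ⟨m', -, hm'⟩ := Nat.exists_mul_mod_eq_one_of_coprime hcop hp.out.one_lt
  have hmm' : ‖(m' : K) * (m : K) - 1‖ < 1 := by
    have hdiv : (m * m' / p) * p + 1 = m * m' := by
      have := Nat.div_add_mod (m * m') p
      rw [hm'] at this
      linarith [Nat.div_add_mod (m * m') p]
    have h : (m' : K) * (m : K) - 1 = (p : K) * ((m * m' / p : ℕ) : K) := by
      have h' : (((m * m' / p) * p + 1 : ℕ) : K) = ((m * m' : ℕ) : K) := by rw [hdiv]
      push_cast at h'
      linear_combination -h'
    rw [h, norm_mul]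
    calc ‖(p : K)‖ * ‖((m * m' / p : ℕ) : K)‖ ≤ ‖(p : K)‖ * 1 := by
          gcongr
          exact hnat _
      _ < 1 := by rw [mul_one]; exact hpn
  -- `a' := m'·a` would hit `b̄`
  have ha' : ‖(m' : K) * a‖ ≤ 1 := by
    rw [norm_mul]
    calc ‖(m' : K)‖ * ‖a‖ ≤ 1 * 1 := by
          gcongr
          exact hnat _
      _ = 1 := mul_one _
  refine hmiss ((m' : K) * a) ha' ?_
  have hlin := norm_natCast_mul_addPoly_sub_lt_one p C m' a ha
  have h2 : ‖(m' : K) * (a + (C : K) * a ^ p) - (m' : K) * ((m : K) * (B : K))‖ < 1 := by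
    rw [← mul_sub, norm_mul, ← norm_neg (a + _ - _), neg_sub]
    calc ‖(m' : K)‖ * ‖(m : K) * (B : K) - (a + (C : K) * a ^ p)‖
          ≤ 1 * ‖(m : K) * (B : K) - (a + (C : K) * a ^ p)‖ :=
          mul_le_mul_of_nonneg_right (hnat _) (norm_nonneg _)
      _ < 1 := by rw [one_mul]; exact hab
  have h3 : ‖(m' : K) * ((m : K) * (B : K)) - (B : K)‖ < 1 := by
    rw [show (m' : K) * ((m : K) * (B : K)) - (B : K) = ((m' : K) * (m : K) - 1) * (B : K) by ring, norm_mul, hb1,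
      mul_one]
    exact hmm'
  have hsplit : (m' : K) * a + (C : K) * ((m' : K) * a) ^ p - (B : K) =
      ((m' : K) * a + (C : K) * ((m' : K) * a) ^ p - (m' : K) * (a + (C : K) * a ^ p)) +
      (((m' : K) * (a + (C : K) * a ^ p) - (m' : K) * ((m : K) * (B : K))) +
        ((m' : K) * ((m : K) * (B : K)) - (B : K))) := by ring
  rw [hsplit]
  refine (IsUltrametricDist.norm_add_le_max _ _).trans_lt (max_lt hlin ?_)
  exact (IsUltrametricDist.norm_add_le_max _ _).trans_lt (max_lt h2 h3)

/-- **`r_in = A + 1 = e/(p−1) + 1` EXACTLY when `ζ_p ∈ K`** (`p` odd, `e = A·(p−1)`, `p ∤ A`), in the R-W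
format: `closedBall 0 ‖ϖ‖^{A+1} ⊆ log_p(𝒪_K^×)` and `¬ closedBall 0 ‖ϖ‖^A ⊆ log_p(𝒪_K^×)`.
[cite: NeukirchANT1999, Ch. II Prop. (5.5)–(5.7)] -/
theorem innerRadius_tie_of_pow_prime_eq_one (hp2 : p ≠ 2) (hpA : ¬ p ∣ A) {ζ : K} (hζ : ζ ^ p = 1)
    (hζ1 : ζ ≠ 1) :
    closedBall (0 : K) (‖(ϖ : K)‖ ^ (A + 1)) ⊆ logUnits K ∧
      ¬ closedBall (0 : K) (‖(ϖ : K)‖ ^ A) ⊆ logUnits K := by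
  refine ⟨?_, not_closedBall_level_subset_logUnits_of_pow_prime_eq_one p hϖ hA hp2 hpA hζ hζ1⟩
  have h := closedBall_div_succ_subset_logUnits p hϖ (K := K)
  rwa [div_eq_level p hA] at h

/-- **THE TIE DICHOTOMY** (`p` odd, `e = A·(p−1)`, `p ∤ A`): the inner radius of `log_p(𝒪_K^×)` is `‖ϖ‖^A` if `K`
has no non-trivial `p`-th root of unity and `‖ϖ‖^{A+1}` otherwise — in both cases `closedBall 0 ‖ϖ‖^r ⊆ Λ`
and `¬ closedBall 0 ‖ϖ‖^{r−1} ⊆ Λ` for the stated `r`. [cite: NeukirchANT1999, Ch. II Prop. (5.5)–(5.7)] -/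
theorem innerRadius_tie_dichotomy (hp2 : p ≠ 2) (hpA : ¬ p ∣ A) :
    ((∀ ζ : K, ζ ^ p = 1 → ζ = 1) ∧ closedBall (0 : K) (‖(ϖ : K)‖ ^ A) ⊆ logUnits K ∧
        ¬ closedBall (0 : K) (‖(ϖ : K)‖ ^ (A - 1)) ⊆ logUnits K) ∨
      ((∃ ζ : K, ζ ^ p = 1 ∧ ζ ≠ 1) ∧ closedBall (0 : K) (‖(ϖ : K)‖ ^ (A + 1)) ⊆ logUnits K ∧
        ¬ closedBall (0 : K) (‖(ϖ : K)‖ ^ A) ⊆ logUnits K) := by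
  by_cases hμ : ∀ ζ : K, ζ ^ p = 1 → ζ = 1
  · exact Or.inl ⟨hμ, innerRadius_tie_of_forall_pow_prime_eq_one p hϖ hA hp2 hpA hμ⟩
  · push Not at hμ
    obtain ⟨ζ, hζ, hζ1⟩ := hμ
    exact Or.inr ⟨⟨ζ, hζ, hζ1⟩, innerRadius_tie_of_pow_prime_eq_one p hϖ hA hp2 hpA hζ hζ1⟩

/-! ### §8. The inner-radius binders of the exact content criterion at tie places -/

/-- **`ζ_p ∈ K`: an explicit element of norm EXACTLY `‖ϖ‖^A` outside `log_p(𝒪_K^×)`** (the missed class of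
§7, read back from `¬ closedBall ⊆ Λ`: an exception of smaller norm would lie in `𝔪^{A+1} ⊆ Λ`).
[cite: NeukirchANT1999, Ch. II Prop. (5.7)] -/
theorem exists_norm_eq_not_mem_logUnits_of_pow_prime_eq_one (hp2 : p ≠ 2) (hpA : ¬ p ∣ A) {ζ : K}
    (hζ : ζ ^ p = 1) (hζ1 : ζ ≠ 1) : ∃ w : K, ‖w‖ = ‖(ϖ : K)‖ ^ A ∧ w ∉ logUnits K := by
  have hρ0 : 0 < ‖(ϖ : K)‖ := norm_units_pos ϖ
  have hϖA0 : (ϖ : K) ^ A ≠ 0 := pow_ne_zero _ ϖ.ne_zero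
  have h := not_closedBall_level_subset_logUnits_of_pow_prime_eq_one p hϖ hA hp2 hpA hζ hζ1
  rw [Set.not_subset] at h
  obtain ⟨w, hw, hwΛ⟩ := h
  rw [mem_closedBall, dist_zero_right] at hw
  refine ⟨w, le_antisymm hw (not_lt.mp fun hlt => hwΛ ?_), hwΛ⟩
  -- `‖w‖ < ‖ϖ‖^A` forces `‖w‖ ≤ ‖ϖ‖^{A+1}`, inside `log_p(𝒪^×)`
  have hq : ‖w / (ϖ : K) ^ A‖ < 1 := by
    rw [norm_div, norm_pow, div_lt_one (pow_pos hρ0 _)]; exact hlt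
  have hq' : ‖w / (ϖ : K) ^ A‖ ≤ ‖(ϖ : K)‖ := hϖ.norm_le_of_norm_lt_one _ hq
  have hw' : ‖w‖ ≤ ‖(ϖ : K)‖ ^ (A + 1) := by
    have : w = (ϖ : K) ^ A * (w / (ϖ : K) ^ A) := by rw [mul_div_cancel₀ _ hϖA0]
    rw [this, norm_mul, norm_pow, pow_succ]
    exact mul_le_mul_of_nonneg_left hq' (pow_nonneg hρ0.le _)
  have hsub := (innerRadius_tie_of_pow_prime_eq_one p hϖ hA hp2 hpA hζ hζ1).1
  exact hsub (by rw [mem_closedBall, dist_zero_right]; exact hw')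

/-- **The inner-radius binders of abc-iut-c312-5's `smul_normalizedPacket_subset_logPacket_iff`, DISCHARGED
at a tie place WITHOUT `ζ_p`**: `c := ϖ^A` is nonzero, `c·R ⊆ log_p(𝒪_K^×)`, and `w := ϖ^{A−1} ∉ log_p(𝒪_K^×)`
with `‖w‖·‖ϖ‖ ≤ ‖c‖` — so `ρ_in = ‖ϖ‖^A = ‖ϖ‖^{e/(p−1)}` there. [cite: NeukirchANT1999, Ch. II Prop. (5.5)–(5.7)] -/
theorem innerRadius_tie_hyps_of_forall_pow_prime_eq_one (hp2 : p ≠ 2) (hpA : ¬ p ∣ A)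
    (hμ : ∀ ζ : K, ζ ^ p = 1 → ζ = 1) :
    (ϖ : K) ^ A ≠ 0 ∧ (∀ o : K, ‖o‖ ≤ 1 → (ϖ : K) ^ A * o ∈ logUnits K) ∧
      ∃ (ϖ' : Kˣ) (w : K), IsUniformizer ϖ' ∧ w ∉ logUnits K ∧ ‖w‖ * ‖(ϖ' : K)‖ ≤ ‖(ϖ : K) ^ A‖ := by
  have hρ0 : 0 < ‖(ϖ : K)‖ := norm_units_pos ϖ
  have hA1 := one_le_level p hA
  refine ⟨pow_ne_zero _ ϖ.ne_zero, fun o ho => ?_, ⟨ϖ, (ϖ : K) ^ (A - 1), hϖ, ?_, le_of_eq ?_⟩⟩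
  · refine closedBall_level_subset_logUnits_of_forall_pow_prime_eq_one p hϖ hA hp2 hpA hμ ?_
    rw [mem_closedBall, dist_zero_right, norm_mul, norm_pow]
    exact mul_le_of_le_one_right (pow_nonneg (norm_nonneg _) _) ho
  · rintro ⟨u, -, hu⟩
    refine norm_unitLog_ne_zpow_pred p hϖ hA hpA u ?_
    rw [hu, norm_pow, ← zpow_natCast, Nat.cast_sub hA1, Nat.cast_one]
  · rw [norm_pow, norm_pow, ← pow_succ, Nat.sub_add_cancel hA1]

/-- **The same binders at a tie place WITH `ζ_p ∈ K`**: `c := ϖ^{A+1}` is nonzero, `c·R ⊆ log_p(𝒪_K^×)`, and the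
element of §8 (norm `‖ϖ‖^A`, not a logarithm) has `‖w‖·‖ϖ‖ ≤ ‖c‖` — so `ρ_in = ‖ϖ‖^{A+1} = ‖ϖ‖^{e/(p−1)+1}`
there. [cite: NeukirchANT1999, Ch. II Prop. (5.5)–(5.7)] -/
theorem innerRadius_tie_hyps_of_pow_prime_eq_one (hp2 : p ≠ 2) (hpA : ¬ p ∣ A) {ζ : K} (hζ : ζ ^ p = 1)
    (hζ1 : ζ ≠ 1) :
    (ϖ : K) ^ (A + 1) ≠ 0 ∧ (∀ o : K, ‖o‖ ≤ 1 → (ϖ : K) ^ (A + 1) * o ∈ logUnits K) ∧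
      ∃ (ϖ' : Kˣ) (w : K), IsUniformizer ϖ' ∧ w ∉ logUnits K ∧ ‖w‖ * ‖(ϖ' : K)‖ ≤ ‖(ϖ : K) ^ (A + 1)‖ := by
  have hρ0 : 0 < ‖(ϖ : K)‖ := norm_units_pos ϖ
  obtain ⟨w, hw, hwΛ⟩ := exists_norm_eq_not_mem_logUnits_of_pow_prime_eq_one p hϖ hA hp2 hpA hζ hζ1
  refine ⟨pow_ne_zero _ ϖ.ne_zero, fun o ho => ?_, ⟨ϖ, w, hϖ, hwΛ, le_of_eq ?_⟩⟩
  · refine (innerRadius_tie_of_pow_prime_eq_one p hϖ hA hp2 hpA hζ hζ1).1 ?_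
    rw [mem_closedBall, dist_zero_right, norm_mul, norm_pow]
    exact mul_le_of_le_one_right (pow_nonneg (norm_nonneg _) _) ho
  · rw [hw, norm_pow, pow_succ]

end Field

end LogEnvelope

end Literature.IUT.LogVolume

end
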